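import Literature.MathematicalPhysics.QuantumFieldTheory.Balaban1983to89.B8Prop3SrcZd3
import Literature.MathematicalPhysics.QuantumFieldTheory.Balaban1983to89.B8Prop3KLevelGamma

/-!
# `Balaban1983to89.B8Prop3SrcZd3Gamma` — [Balaban1985RegularSpaces] Prop. 3 p. 87 ∕ Thm 8 p. 101: `B8Prop3SrcZd3` §2 (Proposition 3 in norm form at
# `k` levels with ADDITIVE SOURCE TERMS on all five (1.59)-lines — the k-level engine of Theorem 8's sourced Proposition-3 socket `SP3src`) IN EDITION γ:
# the constraint-bond class `Λ` under PRINT's box law «box ⊂ Ω_{j−1}» ((1.31) p. 82, crossing contours included), the [3]-Prop.-4 windows at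
# `(L²α₀, L·α₂)`, the (1.56) step by dag-n05-w1's `B8Prop3KLevelGamma.wsup_B1_le_kLevel_γ`, the (1.61)-constant `C₂ ≥ 8·131072(d+1)²e^{…L²α₀}L²` —
# D7-2a of the `Ω₀ = ℤᵈ` road's γ chain (plan START-LIST v3 §n05); its carrier-level consumer (the γ∕P twin of `B8Prop3SrcZd3H.sp3src_zd3H_map_of_sockB9P3srcH`)
# follows on the P-carrier `zdGF3HP` (dag-n05-w1 `B8LeafModelZd3P`, in flight)

statement-level skeleton of published theorems with citation tags; proofs where landed; nothing here is a claim about the Yang–Mills mass gap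

T. Bałaban, *Spaces of regular gauge field configurations on a lattice and gauge fixing conditions*, Commun. Math. Phys. **99** (1985) 75–102
`[Balaban1985RegularSpaces]` ("B8"): Prop. 3 p. 87, (1.55)–(1.62) pp. 86–87, (1.31) p. 82, Thm 8 (1.146) p. 101 («only some constants change their numerical
values»).  PDF held: `paper:balaban1985-cmp99-regular-spaces-gauge-fixing` (journal page = PDF page + 74).

CITATION HEADER (lean-in-tree rule).  Cell `pub-ymgap` (HUMAN RULING D-0062, Track A), DAG node N05 = [B8], seat `pub-ymgap-dag-n05-d` (g10; R134 row s2).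
WHY THIS FILE.  See `B8Prop3GaugeFixedKLevelSrcGamma` (this seat, same day): the typed bond class carries no crossing bond (`B8Prop3ShellModeVacuity`
p585094: the N05 slot is EMPTY as typed); edition γ re-reads every (1.42)∕|B₁| consumer on a PARAMETRIC class under print's box law.  This file is the γ
twin of `B8Prop3SrcZd3` §2 (the bootstraps §1 `apriori_160_src4` ∕ `apriori_160_fifth_src` are class-free and USED BY NAME).

WHAT THIS FILE PROVES (theorems only; proofs = the originals' with `wsup_B1_le_kLevel_γ`).
* `prop3_norms_kLevel_src4_γ` — all four (1.62) members with source terms `S_a S_g S_j S_l`, class under «box ⊂ Ω_{j−1}».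
* `prop3_fifth_kLevel_src_γ` — the Hölder member with source terms `S_g S_h`.

HONEST SCOPE.  Assemblies BY NAME; nothing of (1.42)∕(1.59) is proved (hypotheses `h42`, `h59·`); count-neutral; N05 NOT discharged; `≤` where print has
`<`; `T_η ↦ ℤᵈ`; one finite `T⁴` programme at fixed `ε` — nothing continuum ∕ ℝ⁴ ∕ OS ∕ mass-gap ∕ Clay.  No `sorry`, no `def`, no `instance`, no `notation`.
Unit `pub-ymgap-dag-n05-d` (g10), 2026-08-27.
-/

noncomputable section

open NormedSpace

namespace Literature.MathematicalPhysics.QuantumFieldTheory.Balaban1983to89.B8Prop3SrcZd3Gamma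

open Complex (I)
open MatrixLog B7Prop1Explicit B7Prop2Explicit B7Prop1Local B7Eq92Concrete
open B7Prop2Explicit (C0 c2' unitaryUnits unitaryUnits_le_U1 avgClosed_unitaryUnits)
open B7Prop3Flat (c3)
open B7Prop4GeneralLevels (logCovIter linCovIter)
open B8Lemma1NonAbelian (mulCfg)
open B8Ineq132 (covDerivFwd InAk BondTouches)
open B8Eq146AExpansion (iEta expCfg plaqCovDeriv)
open B8Eq143PlaqExpansion (pdiv)
open B8Eq155JBound (Jcur wsup)
open B8Eq140Level (SideTouches)
open B8Eq184Proof (cfgExp)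
open B8ScaledSupNorm (bondNorm msup weight Bdd)
open B8Eq155KLevelLocal (eq155_norm_kLevel_hermitian)
open B8Prop3KLevelGamma (wsup_B1_le_kLevel_γ)
open B8Prop3KLevel (bound_of_sideTouches)
open B8Eq138LandauZd (IsLandau146W InR138 logCfg covLap)
open B8Prop3GaugeFixedKLevel (inAk_congr_of_sideTouches expCfg_iEta_eq_cfgExp cfgExp_congr_at)
open B8LeafModelZd (ZdIdx)
open B8Prop3SrcZd3 (apriori_160_src4 apriori_160_fifth_src)
open B9Eq340HolderZd (hquot AdmPair)

-- `Site` alone could resolve to the torus sites of `Setup.lean`; re-export the `ℤ^d` sites of `B7Prop1Explicit`.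
export B7Prop1Explicit (Site)

variable {d : ℕ}

/-! ## §1 Proposition 3 in norm form at `k` levels with the sourced (1.59), all four members and the Hölder member, edition γ -/

section Prop3

variable {𝔸 : Type*} [CStarAlgebra 𝔸] [Nontrivial 𝔸]

/-- **PROPOSITION 3 IN NORM FORM AT `k` LEVELS, ALL FOUR MEMBERS, SOURCED (1.59), EDITION γ** (class `Λ` under print's box law «box ⊂ Ω_{j−1}»; windows at `(L²α₀, L·α₂)`; (1.56) by dag-n05-w1's `wsup_B1_le_kLevel_γ`; (1.61)-constant L²-scaled) — n05-b's `B8Prop3KLevel.prop3_norms_kLevel` with additive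
source terms `S_a, S_g, S_j, S_l` on the four (1.59)-lines: `a ≤ 5dLB₀(α₀+α₁) + (S_a + S_g)`, `g ≤ … + 2S_g`, `j₂ ≤ … + (S_j + S_g)`, `l ≤ … + (S_l + S_g)`.
[cite: Balaban1985RegularSpaces, Prop. 3 p.87, (1.55)–(1.62) pp.86–87, Thm 8 p.101] -/
theorem prop3_norms_kLevel_src4_γ (hd2 : 2 ≤ d) {η : ℝ} (hη : 0 < η) {L : ℕ} (hL : 2 ≤ L) {k : ℕ}
    {U₀ : Site d → Fin d → 𝔸ˣ} (hU₀ : ∀ y κ, U₀ y κ ∈ unitaryUnits 𝔸)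
    {A : Site d → Fin d → 𝔸} (hAh : ∀ y κ, IsSelfAdjoint (A y κ)) {α₀ α₁ α₂ g : ℝ}
    (hα₀ : 0 < α₀) (hα₁ : 0 ≤ α₁) (hα₂ : 0 ≤ α₂) (hg0 : 0 ≤ g)
    -- [3] Prop. 4's linearisation windows ONE LEVEL LOWER (edition γ: the box of a level-`j` datum bond lies in `Ω_{j−1}`)
    (hα3 : C0 d * ((L : ℝ) ^ 2 * α₀) ≤ 1 / 3) (hα4 : 4 * ((L : ℝ) ^ 2 * α₀) ≤ c2' d L)
    (h16 : 16 * α₂ ≤ 1) (hd5 : 5 * α₂ * ((d : ℝ) - 1) ≤ 4)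
    (hsmall : Real.exp (4 * (800 * ((d : ℝ) + 1) ^ 2 * ((d : ℝ) + 4)) * ((L : ℝ) ^ 2 * α₀))
      * (1 + 8 * (131072 * ((d : ℝ) + 1) ^ 2) * ((L : ℝ) * α₂)) ≤ 2)
    (hc₃ : 2 * ((L : ℝ) * α₂) ≤ c3 d L) {B₀ : ℝ} (hB₀ : 0 ≤ B₀) (hside : 36 * d * B₀ * α₂ ≤ 1 / 2) (h50 : 50 * d * α₂ ≤ 1)
    {C₂ : ℝ} (hC₂ : 8 * (131072 * ((d : ℝ) + 1) ^ 2) * Real.exp (4 * (800 * ((d : ℝ) + 1) ^ 2 * ((d : ℝ) + 4)) * ((L : ℝ) ^ 2 * α₀))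
      * (L : ℝ) ^ 2 ≤ C₂)
    (h61 : 2 * α₂ ^ 2 + 20 * d * α₀ * α₂ + 2 * C₂ * α₂ ^ 2 ≤ α₀ + α₁)
    {Ω : ℕ → Set (Site d)} {Λ : ℕ → Set (Site d × Fin d)}
    (hbox : ∀ j, j ≤ k → ∀ c ∈ Λ j, ∀ x, InBox (loK L j c.1) (bondHiK L j c.1 c.2) x → x ∈ Ω (j - 1))
    (h40₀ : InAk L k η α₀ Ω U₀) (h40₁ : InAk L k η α₀ Ω (mulCfg (expCfg (iEta η A)) U₀))
    (h41 : ∀ j, j ≤ k → ∀ y τ, SideTouches (Ω j) y τ → ‖A y τ‖ ≤ α₂ * ((L : ℝ) ^ j * η)⁻¹)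
    (hg : ∀ j, j ≤ k → ∀ (y : Site d) (κ τ : Fin d), SideTouches (Ω j) y τ →
      ((L : ℝ) ^ j * η) ^ 2 * ‖covDerivFwd η U₀ κ (fun z => A z τ) y‖ ≤ g)
    (h42 : ∀ j, j ≤ k → ∀ c ∈ Λ j, ‖logCovIter L U₀ (iEta η A) j c.1 c.2‖ < 2 * d * L * α₁)
    {a j₂ l Sa Sg Sj Sl : ℝ}
    (h59a : a ≤ B₀ * (bondNorm L k η (-(3 : ℝ)) Ω (fun x μ => Jcur η U₀ A μ x)
      + wsup 1 (fun p : {p : ℕ × (Site d × Fin d) // p.1 ≤ k ∧ p.2 ∈ Λ p.1} =>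
          linCovIter L U₀ (iEta η A) p.1.1 p.1.2.1 p.1.2.2)) + Sa)
    (h59g : g ≤ B₀ * (bondNorm L k η (-(3 : ℝ)) Ω (fun x μ => Jcur η U₀ A μ x)
      + wsup 1 (fun p : {p : ℕ × (Site d × Fin d) // p.1 ≤ k ∧ p.2 ∈ Λ p.1} =>
          linCovIter L U₀ (iEta η A) p.1.1 p.1.2.1 p.1.2.2)) + Sg)
    (h59j : j₂ ≤ B₀ * (bondNorm L k η (-(3 : ℝ)) Ω (fun x μ => Jcur η U₀ A μ x)
      + wsup 1 (fun p : {p : ℕ × (Site d × Fin d) // p.1 ≤ k ∧ p.2 ∈ Λ p.1} =>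
          linCovIter L U₀ (iEta η A) p.1.1 p.1.2.1 p.1.2.2)) + Sj)
    (h59l : l ≤ B₀ * (bondNorm L k η (-(3 : ℝ)) Ω (fun x μ => Jcur η U₀ A μ x)
      + wsup 1 (fun p : {p : ℕ × (Site d × Fin d) // p.1 ≤ k ∧ p.2 ∈ Λ p.1} =>
          linCovIter L U₀ (iEta η A) p.1.1 p.1.2.1 p.1.2.2)) + Sl) :
    a ≤ 5 * d * L * B₀ * (α₀ + α₁) + (Sa + Sg) ∧ g ≤ 5 * d * L * B₀ * (α₀ + α₁) + 2 * Sg ∧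
    j₂ ≤ 5 * d * L * B₀ * (α₀ + α₁) + (Sj + Sg) ∧ l ≤ 5 * d * L * B₀ * (α₀ + α₁) + (Sl + Sg) := by
  have hL1 : 1 ≤ L := le_trans (by norm_num) hL
  have h₀ : ∀ y κ, U₀ y κ ∈ U1 𝔸 := fun y κ => unitaryUnits_le_U1 (hU₀ y κ)
  -- (1.55) at `k` levels (`B8Eq155KLevelLocal`)
  have h55 := eq155_norm_kLevel_hermitian hη hL1 h₀ hAh hα₀.le hα₂ h16 hd5 hg0 h40₀ h40₁ h41 hg
  -- (1.56) at `k` levels (`B8Eq156KLevelLocal`), with (1.41) moved to the bonds touching `Ω_j`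
  have h41' : ∀ j, j ≤ k → ∀ x μ, BondTouches (Ω j) x μ → ‖A x μ‖ ≤ α₂ * ((L : ℝ) ^ j * η)⁻¹ :=
    fun j hj x μ hb => bound_of_sideTouches hd2 (h41 j hj) x μ hb
  have h56' := wsup_B1_le_kLevel_γ hη L hL (avgClosed_unitaryUnits d L) U₀ hU₀ hα₀ hα3 hα4 A hα₂ hsmall hc₃ hbox h40₀
    h41' hα₁ h42
  have h56 : wsup 1 (fun p : {p : ℕ × (Site d × Fin d) // p.1 ≤ k ∧ p.2 ∈ Λ p.1} =>
        linCovIter L U₀ (iEta η A) p.1.1 p.1.2.1 p.1.2.2)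
      ≤ 2 * d * L * α₁ + (8 * (131072 * ((d : ℝ) + 1) ^ 2)
          * Real.exp (4 * (800 * ((d : ℝ) + 1) ^ 2 * ((d : ℝ) + 4)) * ((L : ℝ) ^ 2 * α₀)) * (L : ℝ) ^ 2) * α₂ ^ 2 := by
    refine h56'.trans (le_of_eq ?_); ring
  -- the bootstrap (1.55) + (1.56) + (1.59) ⇒ (1.60), with `C₂(d, α₀)`
  obtain ⟨ha, hg', hj, hl⟩ := apriori_160_src4 (Nat.cast_nonneg d) hB₀ hα₂ hg0 h55 h56 h59a h59g h59j h59l hside h50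
  -- `C₂(d, α₀) ≤ C₂`, so (1.60) holds with `C₂`
  set R₀ := B₀ * (4 * α₀ + 4 * d * L * α₁ + 2 * α₂ ^ 2 + 20 * d * α₀ * α₂
      + 2 * (8 * (131072 * ((d : ℝ) + 1) ^ 2) * Real.exp (4 * (800 * ((d : ℝ) + 1) ^ 2 * ((d : ℝ) + 4)) * ((L : ℝ) ^ 2 * α₀))
        * (L : ℝ) ^ 2) * α₂ ^ 2) with hR₀
  set R₁ := B₀ * (4 * α₀ + 4 * d * L * α₁ + 2 * α₂ ^ 2 + 20 * d * α₀ * α₂ + 2 * C₂ * α₂ ^ 2) with hR₁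
  have hR : R₀ ≤ R₁ := by
    rw [hR₀, hR₁]
    apply mul_le_mul_of_nonneg_left _ hB₀
    have hsq : 0 ≤ α₂ ^ 2 := sq_nonneg _
    nlinarith [mul_le_mul_of_nonneg_right hC₂ hsq]
  -- (1.60) + (1.61) ⇒ (1.62) (`B8.apriori_162`)
  have hd' : (1 : ℝ) ≤ d := by exact_mod_cast (le_trans (by norm_num) hd2)
  have hdL : (1 : ℝ) ≤ (d : ℝ) * L := by
    have hL' : (1 : ℝ) ≤ L := by exact_mod_cast hL1
    nlinarith
  have h162 : R₁ ≤ 5 * d * L * B₀ * (α₀ + α₁) := by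
    rw [hR₁]
    exact B8.apriori_162 hB₀ hdL hα₀.le hα₁ h61
  exact ⟨by linarith [hR.trans h162], by linarith [hR.trans h162], by linarith [hR.trans h162], by linarith [hR.trans h162]⟩

/-- **(1.62), HÖLDER MEMBER, AT `k` LEVELS, SOURCED (1.59), EDITION γ** (class under «box ⊂ Ω_{j−1}», windows at `(L²α₀, L·α₂)`) — n05-b's `B8Prop3KLevel.prop3_fifth_kLevel` with the gradient line sourced by
`S_g ≥ 0` and the Hölder line by `S_h`: `h ≤ 5dL·B₀(β)·(α₀ + α₁) + 2B₀(β)S_g + S_h`. [cite: Balaban1985RegularSpaces, Prop. 3 (1.62) p.87, (1.36) p.82, (1.59)–(1.61) p.86, Thm 8 p.101] -/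
theorem prop3_fifth_kLevel_src_γ (hd2 : 2 ≤ d) {η : ℝ} (hη : 0 < η) {L : ℕ} (hL : 2 ≤ L) {k : ℕ}
    {U₀ : Site d → Fin d → 𝔸ˣ} (hU₀ : ∀ y κ, U₀ y κ ∈ unitaryUnits 𝔸)
    {A : Site d → Fin d → 𝔸} (hAh : ∀ y κ, IsSelfAdjoint (A y κ)) {α₀ α₁ α₂ g : ℝ}
    (hα₀ : 0 < α₀) (hα₁ : 0 ≤ α₁) (hα₂ : 0 ≤ α₂) (hg0 : 0 ≤ g)
    -- [3] Prop. 4's linearisation windows ONE LEVEL LOWER (edition γ: the box of a level-`j` datum bond lies in `Ω_{j−1}`)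
    (hα3 : C0 d * ((L : ℝ) ^ 2 * α₀) ≤ 1 / 3) (hα4 : 4 * ((L : ℝ) ^ 2 * α₀) ≤ c2' d L)
    (h16 : 16 * α₂ ≤ 1) (hd5 : 5 * α₂ * ((d : ℝ) - 1) ≤ 4)
    (hsmall : Real.exp (4 * (800 * ((d : ℝ) + 1) ^ 2 * ((d : ℝ) + 4)) * ((L : ℝ) ^ 2 * α₀))
      * (1 + 8 * (131072 * ((d : ℝ) + 1) ^ 2) * ((L : ℝ) * α₂)) ≤ 2)
    (hc₃ : 2 * ((L : ℝ) * α₂) ≤ c3 d L) {B₀ B₀β : ℝ} (hB₀ : 0 ≤ B₀) (hB₀β : 0 ≤ B₀β) (hside : 36 * d * B₀ * α₂ ≤ 1 / 2)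
    (h50 : 50 * d * α₂ ≤ 1)
    {C₂ : ℝ} (hC₂ : 8 * (131072 * ((d : ℝ) + 1) ^ 2) * Real.exp (4 * (800 * ((d : ℝ) + 1) ^ 2 * ((d : ℝ) + 4)) * ((L : ℝ) ^ 2 * α₀))
      * (L : ℝ) ^ 2 ≤ C₂)
    (h61 : 2 * α₂ ^ 2 + 20 * d * α₀ * α₂ + 2 * C₂ * α₂ ^ 2 ≤ α₀ + α₁)
    {Ω : ℕ → Set (Site d)} {Λ : ℕ → Set (Site d × Fin d)}
    (hbox : ∀ j, j ≤ k → ∀ c ∈ Λ j, ∀ x, InBox (loK L j c.1) (bondHiK L j c.1 c.2) x → x ∈ Ω (j - 1))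
    (h40₀ : InAk L k η α₀ Ω U₀) (h40₁ : InAk L k η α₀ Ω (mulCfg (expCfg (iEta η A)) U₀))
    (h41 : ∀ j, j ≤ k → ∀ y τ, SideTouches (Ω j) y τ → ‖A y τ‖ ≤ α₂ * ((L : ℝ) ^ j * η)⁻¹)
    (hg : ∀ j, j ≤ k → ∀ (y : Site d) (κ τ : Fin d), SideTouches (Ω j) y τ →
      ((L : ℝ) ^ j * η) ^ 2 * ‖covDerivFwd η U₀ κ (fun z => A z τ) y‖ ≤ g)
    (h42 : ∀ j, j ≤ k → ∀ c ∈ Λ j, ‖logCovIter L U₀ (iEta η A) j c.1 c.2‖ < 2 * d * L * α₁)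
    {h Sg Sh : ℝ} (hSg : 0 ≤ Sg)
    (h59g : g ≤ B₀ * (bondNorm L k η (-(3 : ℝ)) Ω (fun x μ => Jcur η U₀ A μ x)
      + wsup 1 (fun p : {p : ℕ × (Site d × Fin d) // p.1 ≤ k ∧ p.2 ∈ Λ p.1} =>
          linCovIter L U₀ (iEta η A) p.1.1 p.1.2.1 p.1.2.2)) + Sg)
    (h59h : h ≤ B₀β * (bondNorm L k η (-(3 : ℝ)) Ω (fun x μ => Jcur η U₀ A μ x)
      + wsup 1 (fun p : {p : ℕ × (Site d × Fin d) // p.1 ≤ k ∧ p.2 ∈ Λ p.1} =>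
          linCovIter L U₀ (iEta η A) p.1.1 p.1.2.1 p.1.2.2)) + Sh) :
    h ≤ 5 * d * L * B₀β * (α₀ + α₁) + (2 * B₀β * Sg + Sh) := by
  have hL1 : 1 ≤ L := le_trans (by norm_num) hL
  have h₀ : ∀ y κ, U₀ y κ ∈ U1 𝔸 := fun y κ => unitaryUnits_le_U1 (hU₀ y κ)
  have h55 := eq155_norm_kLevel_hermitian hη hL1 h₀ hAh hα₀.le hα₂ h16 hd5 hg0 h40₀ h40₁ h41 hg
  have h41' : ∀ j, j ≤ k → ∀ x μ, BondTouches (Ω j) x μ → ‖A x μ‖ ≤ α₂ * ((L : ℝ) ^ j * η)⁻¹ :=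
    fun j hj x μ hb => bound_of_sideTouches hd2 (h41 j hj) x μ hb
  have h56' := wsup_B1_le_kLevel_γ hη L hL (avgClosed_unitaryUnits d L) U₀ hU₀ hα₀ hα3 hα4 A hα₂ hsmall hc₃ hbox h40₀
    h41' hα₁ h42
  have h56 : wsup 1 (fun p : {p : ℕ × (Site d × Fin d) // p.1 ≤ k ∧ p.2 ∈ Λ p.1} =>
        linCovIter L U₀ (iEta η A) p.1.1 p.1.2.1 p.1.2.2)
      ≤ 2 * d * L * α₁ + (8 * (131072 * ((d : ℝ) + 1) ^ 2)
          * Real.exp (4 * (800 * ((d : ℝ) + 1) ^ 2 * ((d : ℝ) + 4)) * ((L : ℝ) ^ 2 * α₀)) * (L : ℝ) ^ 2) * α₂ ^ 2 := by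
    refine h56'.trans (le_of_eq ?_); ring
  have hnB : 0 ≤ wsup 1 (fun p : {p : ℕ × (Site d × Fin d) // p.1 ≤ k ∧ p.2 ∈ Λ p.1} =>
      linCovIter L U₀ (iEta η A) p.1.1 p.1.2.1 p.1.2.2) := B8Eq155JBound.wsup_nonneg zero_le_one _
  have h160 := apriori_160_fifth_src (Nat.cast_nonneg d) hB₀ hB₀β hα₀.le hα₂ hg0 hnB hSg h55 h56 h59g h59h hside h50
  -- `C₂(d, α₀) ≤ C₂`
  have h160' : h ≤ B₀β * (4 * α₀ + 4 * d * L * α₁ + 2 * α₂ ^ 2 + 20 * d * α₀ * α₂ + 2 * C₂ * α₂ ^ 2) + (2 * B₀β * Sg + Sh) := by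
    have hsq : 0 ≤ α₂ ^ 2 := sq_nonneg _
    have hm : B₀β * (4 * α₀ + 4 * d * L * α₁ + 2 * α₂ ^ 2 + 20 * d * α₀ * α₂ +
        2 * (8 * (131072 * ((d : ℝ) + 1) ^ 2) * Real.exp (4 * (800 * ((d : ℝ) + 1) ^ 2 * ((d : ℝ) + 4)) * ((L : ℝ) ^ 2 * α₀))
          * (L : ℝ) ^ 2) * α₂ ^ 2)
        ≤ B₀β * (4 * α₀ + 4 * d * L * α₁ + 2 * α₂ ^ 2 + 20 * d * α₀ * α₂ + 2 * C₂ * α₂ ^ 2) := by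
      apply mul_le_mul_of_nonneg_left _ hB₀β
      nlinarith [mul_le_mul_of_nonneg_right hC₂ hsq]
    linarith [h160, hm]
  have hd' : (1 : ℝ) ≤ d := by exact_mod_cast (le_trans (by norm_num) hd2)
  have hdL : (1 : ℝ) ≤ (d : ℝ) * L := by
    have hL' : (1 : ℝ) ≤ L := by exact_mod_cast hL1
    nlinarith
  have h162 := B8.apriori_162 hB₀β hdL hα₀.le hα₁ h61
  linarith [h160', h162]

end Prop3

#print axioms prop3_norms_kLevel_src4_γ
#print axioms prop3_fifth_kLevel_src_γ

end Literature.MathematicalPhysics.QuantumFieldTheory.Balaban1983to89.B8Prop3SrcZd3Gamma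

end
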